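import Summits.QuantumFields.BalabanUV.Beta.GAN24.WrecAtEvenHalfRows
import Summits.QuantumFields.BalabanUV.Beta.GAN24.CombSecondOrderCarrierParity
import Summits.QuantumFields.BalabanUV.Beta.GAN24.KSlotCombChart

/-!
# `BalabanUV.Beta.GAN24.CombWrecEvenHalfRows` — binder row G-an2-4 ∕ (CONV-C), TRANSFER-III, LINK L9 OF (α-0) AT ROW D1's LITERAL OF RECORD (III′): **THE W-SLOT ROWS
# (hW, hWall) OF THE EVEN HALF `½ • (W′_j + P W′_j)` OF THE COMB-CHART W-TABLE `W′_j = WcombOf tabs … j` AS FUNCTIONS OF THE K-ROWS OF `unitK_j (GcombSh Lc j)`,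
# «S′Shape» ∧ «S′Drift» ON `unitS_j (SpureCombOf tabs … j)`, THE MULTIPLIER-SLOT ROWS, AND THE EVEN MEMBER's TWO T₂ ROWS «T2Shape^{ev}» ∧ «T2Drift^{ev}»**
# (`P := sgnK ∘ trK` slotwise; generic `d`, ANY `tabs : SymTables d Lc`, all pins) — the (III′) twin of road-P2 g45's PART 1 `WrecAtEvenHalfRows`
# (G-an2-4 CRUX TEAM (2), leaf prover `b2b-balaban-gan24-formalise-leaf-02`, gen 79; R-gan24p1-g46-2 row «L8b–L9»; road-P2's first refusal honoured by INTENT I-leaf02-g79-2)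

NOT IN PRINT; OUR BOOKKEEPING ([folklore] kernel bookkeeping BY NAME over road-P2 g45's generic §0 of `WrecAtEvenHalfRows` (`W2SymOfK_zero_zero`, `unitS₂_evenHalf`,
`unitM₂_evenHalf`, `unitM₂_zero`), leaf-03 g79's L5 `CombSecondOrderCarrierParity.evenHalf_WcombOf`, an1's `vertexFamily₂_W2SymOfK`, leaf-07's `vertexFamily₂_W2SymOfK_sub` ∕
`unitM₂_M2Of_eq` ∕ `m1_unit_factor`; 0 `def`, 0 cited fact, 0 `def … : Prop`, 0 sorry).
HONEST FRAMING (cell contract, verbatim): «discharging `BetaPertH` makes Bałaban's UV stability UNCONDITIONAL — a real constructive-QFT result; it is NOT the continuum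
limit and NOT the Clay problem.»  HONEST DEPENDENCY (verbatim): «continuum YM on T⁴ ⇐ BetaPertH ∧ nine spine estimates (0/9 proved); BetaPertH ⇐ (D1) ∧ (D4) ∧ CAP+tail;
G-an2-4 gates asym, D1 and NE2/3/4.»

WHY.  After (α-0) the (III′) END (the OWNER's T1 §5, leaf-01's `CombChartSlotJunction`, MY `CombTowerEndOfSlotsK` §5) reads the comb-chart W-table only through the W-rows of
its EVEN half; leaf-03's L5 `evenHalf_WcombOf` writes that half as the symmetrised carrier over `G′_j = GcombSh Lc j` on the even halves of `T̃′_j` and `M2Of tabs.mixFF j` MINUS the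
carrier at ZERO second-order tables (`W2SymOfK_zero_zero`); the units commute with the parity half, so the rows follow from the carrier rows applied twice and subtracted — as at (E).
The OWNER's T4 `CombT2ShapeEvenEnd` ∕ T5 `CombT2DriftEvenEnd` conclude the two T₂ rows at (III′).

WHAT (generic `d`, `[NeZero Lc]`; 0 `def`):
* §0 `unitM_M1Of_eq_of_ff` — for a field–field-valued `H`, `unitM_j (M1Of d Lc H cΛ j) = cΛ • H` (`j`-FREE; slot twin of road-P2's `unitM_M1At_eq`); `unitM_symTablesAn1S2_M`.
* §1 **`unitW_evenHalf_WcombOf`** (table parities (V-p)(H-p)(M-p) displayed, any units `s_f s_m ≠ 0`): `unitW s_f s_m (½ • (W′_j + P W′_j)) = W2SymOfK (unitK G′_j) Lc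
  (unitS S′_j) (unitM (tabs.M j)) ((unitS₂ T̃′_j)^{ev}) ((unitM₂ (M2Of tabs.mixFF j))^{ev}) − W2SymOfK (unitK G′_j) Lc (unitS S′_j) (unitM (tabs.M j)) 0 0`;
  **`unitW_evenHalf_WcombOf_an1`** — the same at an1's record `symTablesAn1S2 d Lc cΛt`, parities discharged (an1's `trK_symVhSAt ∕ trK_symHessFFAt ∕ trK_M1Of_symHessFFAt`).
* §2 THE CARRIER ROWS OVER GENERIC SLOT FAMILIES `Kf Sf Mf : ℕ → …` (no comb object; road-P2's §2 with the three first-order slots as LETTERS):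
  `vertexFamily₂_carrier_of_unitRows` (uniform), `vertexFamily₂_carrier_cauchy_of_unitRows` (geometric Cauchy, ratio `max (max θK θS) (max θM θ₂)`).
* §3 **`hW_hWall_evenHalf_WcombOf_of_shapes`** — (hW, hWall) OF THE EVEN HALF of `WcombOf tabs … j` (left sides spelled EXACTLY as `CombChartSlotJunction` ∕ MY END §5)
  ⟸ K-rows on `unitK_j (GcombSh Lc j)` ∧ «S′Shape» ∧ «S′Drift» ∧ M-rows on `unitM_j (tabs.M j)` ∧ «T2Shape^{ev}» `hT₂` ∧ «T2Drift^{ev}» `hT₂d` (+ `hfm hm`); ONE ratio, ONE rate.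
* §4 **`hW_hWall_evenHalf_WcombOf_an1_three`** — `d = 3`, an1's record, `2 ≤ Lc`: K-rows (MY `kSlotCombSh_holds`) and M-rows (§0) DISCHARGED: ⟸ «S′Shape» ∧ «S′Drift» ∧ the T₂ rows.
Asserts NO bound on Bałaban's tables beyond the displayed rows; discharges NOTHING of «T2Shape^{ev}» ∕ «T2Drift^{ev}» ∕ `hb` ∕ `hZ` ∕ `hy` ∕ `hbd` ∕ `hcell` ∕ `hcelld` ∕ (C)sym ∕
(Q-L) ∕ the S′-rows ∕ any VALUE; the (III′) campaign is NOT asked (an2 W-4) — typed while idle under R-gan24p1-g46-2; NEVER «G-an2-4 closed» as (CONV-C); NOT D1, NOT `BetaPertH`,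
NOT continuum, NOT Clay.  2026-08-25; no existing file touched.
-/

noncomputable section

open scoped BigOperators
open Literature.MathematicalPhysics.QuantumFieldTheory
open Literature.MathematicalPhysics.QuantumFieldTheory.Balaban1983to89
open Literature.MathematicalPhysics.QuantumFieldTheory.Balaban1983to89.Beta
open ExpKernelCalculus (MKer Decays BiLoc VertexFamily VertexFamily₂)
open OneStepResolventKernel (Fib LocStencil decays_mono biLoc_mono)
open BalabanStepW2 (biLoc_le_mono)
open BalabanCompositeJets (LocStencil₂)
open SecondOrderResponse (dM K2OfK W2SymOfK LocStencilFM vertexFamily₂_W2SymOfK CW2 biLoc_smul)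
open BalabanStepW2 (M2Of wM1)
open AveragingContoursRooted (ctr)
open Summit.QuantumFields.BalabanUV.Beta.TameKernelCalculus (trK trK_apply)
open Summit.QuantumFields.BalabanUV.Beta.BorderedHessian (sgnK sgnK_apply)
open Summit.QuantumFields.BalabanUV.Beta.HessKerDressedUnits (unitK unitS unitW unitW_sub legScale legScale_inl legScale_inr)
open Summit.QuantumFields.BalabanUV.Beta.SecondOrderUnits (unitM unitS₂ unitM₂ unitM_apply unitW_W2SymOfK)
open Summit.QuantumFields.BalabanUV.Beta.SpineRooted (M1Of T2RecOf)
open Summit.QuantumFields.BalabanUV.Beta.SymmetrisedStepJets (SymTables)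
open Summit.QuantumFields.BalabanUV.Beta.SymAveragingHessianCounts (symHessFFAt symHessFFAt_inl_inr symHessFFAt_inr symHessFFAt_hH_ctr)
open Summit.QuantumFields.BalabanUV.Beta.SymAveragingMixedJetTables (symMixFFAt_inl_inr symMixFFAt_inr)
open Summit.QuantumFields.BalabanUV.Beta.GAN24.KSlotCombChart (kSlotCombSh_holds)
open Summit.QuantumFields.BalabanUV.Beta.CombChartStepJets (GcombSh SpureCombOf WcombOf)
open Summit.QuantumFields.BalabanUV.Beta.SymTablesAn1FirstOrder (trK_symVhSAt trK_symHessFFAt trK_M1Of_symHessFFAt)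
open Summit.QuantumFields.BalabanUV.Beta.SymSecondOrderTablesAn1 (symTablesAn1S2)
open Summit.QuantumFields.BalabanUV.Beta.HessKerConvCKPlug (vertexFamily₂_mono')
open BalabanStepJets (vertexFamily₂_mono)
open Summit.QuantumFields.BalabanUV.Beta.GAN24.CombesThomas (sfStep smStep sfStep_ne_zero smStep_ne_zero)
open Summit.QuantumFields.BalabanUV.Beta.GAN24.StencilSlotOfShapes (locStencil_mono')
open Summit.QuantumFields.BalabanUV.Beta.GAN24.WSlotOfShapes (m1_unit_factor unitM₂_M2Of_eq)
open Summit.QuantumFields.BalabanUV.Beta.GAN24.WSlotCauchyOfShapes (locStencil₂_le_mono vertexFamily_zero locStencilFM_zero mul_pow_le_mul_pow)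
open Summit.QuantumFields.BalabanUV.Beta.GAN24.SecondOrderLipschitzW2 (LW2 LW2_mul vertexFamily₂_W2SymOfK_sub)
open Summit.QuantumFields.BalabanUV.Beta.GAN24.W3SourceRows (unitS₂_zero locStencil₂_zero_table)
open Summit.QuantumFields.BalabanUV.Beta.GAN24.WSlotSupRate (vertexFamily₂_sub')
open Summit.QuantumFields.BalabanUV.Beta.GAN24.SecondOrderCarrierParity (locStencilFM_evenHalf)
open Summit.QuantumFields.BalabanUV.Beta.GAN24.WrecAtEvenHalfRows (W2SymOfK_zero_zero unitS₂_evenHalf unitM₂_evenHalf unitM₂_zero)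
open Summit.QuantumFields.BalabanUV.Beta.GAN24.CombSecondOrderCarrierParity (evenHalf_WcombOf)

namespace Summit.QuantumFields.BalabanUV.Beta.GAN24.CombWrecEvenHalfRows

variable {d : ℕ} {Lc : ℕ} [NeZero Lc]

/-! ## §0 The multiplier slot over a field–field table is `j`-free in the adopted units -/

/-- [folklore] **`unitM_j (M1Of d Lc H cΛ j) = cΛ • H` FOR A FIELD–FIELD-VALUED TABLE `H`** (the weight `wM1 j` cancels the unit factor exactly — `m1_unit_factor`;
the slot twin of road-P2's `WrecAtSlotOfShapes.unitM_M1At_eq`). -/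
theorem unitM_M1Of_eq_of_ff (H : Fin (d + 1) → (Fin (d + 1) → ℤ) → MKer (d + 1) (Fib d))
    (hfm : ∀ μ w x z (α μ' : Fin (d + 1)), H μ w x z (Sum.inl α) (Sum.inr μ') = 0)
    (hm : ∀ μ w x z (μ' : Fin (d + 1)) (b : Fib d), H μ w x z (Sum.inr μ') b = 0) (cΛ : ℝ) (j : ℕ) :
    unitM (sfStep Lc j) (smStep d Lc j) (M1Of d Lc H cΛ j) = fun μ w => cΛ • H μ w := by
  have hfac := m1_unit_factor (d := d) (Lc := Lc) j
  funext μ w x z a b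
  simp only [unitM_apply, M1Of, Pi.smul_apply, smul_eq_mul]
  rcases a with α | m <;> rcases b with β | n
  · rw [legScale_inl, legScale_inl]
    calc (smStep d Lc j * smStep d Lc j)⁻¹ *
          ((sfStep Lc j)⁻¹ * (cΛ * wM1 d Lc j * H μ w x z (Sum.inl α) (Sum.inl β)) * (sfStep Lc j)⁻¹)
        = ((smStep d Lc j * smStep d Lc j)⁻¹ * ((sfStep Lc j)⁻¹ * (sfStep Lc j)⁻¹) * wM1 d Lc j) *
            (cΛ * H μ w x z (Sum.inl α) (Sum.inl β)) := by ring
      _ = cΛ * H μ w x z (Sum.inl α) (Sum.inl β) := by rw [hfac, one_mul]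
  · simp only [hfm, mul_zero, zero_mul]
  · simp only [hm, mul_zero, zero_mul]
  · simp only [hm, mul_zero, zero_mul]

/-- [folklore] **an1's RECORD: the multiplier slot in units is `cΛt • symHessFFAt ρ_c Lc`, `j`-FREE** (`(symTablesAn1S2 d Lc cΛt).M = M1Of d Lc (symHessFFAt ρ_c Lc) cΛt`
by `rfl`; §0 with an1's block letters `symHessFFAt_inl_inr ∕ symHessFFAt_inr`). -/
theorem unitM_symTablesAn1S2_M (cΛt : ℝ) (j : ℕ) :
    unitM (sfStep Lc j) (smStep d Lc j) ((symTablesAn1S2 d Lc cΛt).M j) = fun μ w => cΛt • symHessFFAt (ctr (d + 1) Lc) Lc μ w :=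
  unitM_M1Of_eq_of_ff (symHessFFAt (ctr (d + 1) Lc) Lc) (fun μ w x z α μ' => symHessFFAt_inl_inr _ _ μ w x z α μ')
    (fun μ w x z μ' b => symHessFFAt_inr _ _ μ w x z μ' b) cΛt j

/-! ## §1 The even half of the comb-chart W-table, in the adopted units, is a DIFFERENCE of two symmetrised carriers over the normalised comb slots -/

section Literal

variable (tabs : SymTables d Lc) (cE cVH cΛ cE₂ cB : ℝ) (T : Fin 4 → Fin 4 → Fin 4 → Fin 4 → ℝ)

/-- [folklore] **THE EVEN HALF OF `WcombOf tabs … j` IN ANY UNITS = THE CARRIER OVER `unitK G′_j` ON THE EVEN HALVES OF THE NORMALISED SECOND-ORDER COMB TABLES MINUS THE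
CARRIER AT ZERO SECOND-ORDER TABLES** (table parities (V-p)(H-p)(M-p) displayed — the OWNER's `CombEvenTowerAutonomy` §2 binders): leaf-03's `evenHalf_WcombOf` ⨾
`W2SymOfK_zero_zero` ⨾ `unitW_sub` ⨾ `unitW_W2SymOfK` ⨾ `unitS₂_evenHalf` ∕ `unitM₂_evenHalf` ∕ `unitS₂_zero` ∕ `unitM₂_zero`.  The left side is spelled EXACTLY as leaf-01's
`CombChartSlotJunction` ∕ `CombTowerEndOfSlotsK` §5 spell the even-half W-slot rows; the `S₂`-slot on the right EXACTLY as the OWNER's T4 `CombT2ShapeEvenEnd` (`ε = 1`). -/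
theorem unitW_evenHalf_WcombOf
    (hVp : ∀ (κ : Fin (d + 1)) (u : Fin (d + 1) → ℤ), trK (tabs.V κ u) = -sgnK (tabs.V κ u))
    (hHp : ∀ (μ : Fin (d + 1)) (y : Fin (d + 1) → ℤ), trK (tabs.H μ y) = -sgnK (tabs.H μ y))
    (hMp : ∀ (j : ℕ) (ρ : Fin (d + 1)) (w : Fin (d + 1) → ℤ), trK (tabs.M j ρ w) = -sgnK (tabs.M j ρ w))
    {sf sm : ℝ} (hsf : sf ≠ 0) (hsm : sm ≠ 0) (j : ℕ) :
    unitW sf sm (fun μ y ν y' => ((1 : ℝ) / 2) • (WcombOf tabs cE cVH cΛ cE₂ cB T j μ y ν y'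
        + sgnK (trK (WcombOf tabs cE cVH cΛ cE₂ cB T j μ y ν y')))) =
      W2SymOfK (unitK sf sm (GcombSh (d := d) Lc j)) Lc (unitS sf sm (SpureCombOf tabs cE cVH cΛ j)) (unitM sf sm (tabs.M j))
          (((1 : ℝ) / 2) • (unitS₂ sf sm (T2RecOf d Lc (GcombSh Lc) (SpureCombOf tabs cE cVH cΛ) tabs.M cE₂ cB T tabs.vh₂S tabs.mixFF j) + fun κ u κ' u' =>
            sgnK (trK (unitS₂ sf sm (T2RecOf d Lc (GcombSh Lc) (SpureCombOf tabs cE cVH cΛ) tabs.M cE₂ cB T tabs.vh₂S tabs.mixFF j) κ u κ' u'))))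
          (fun κ u ρ w => (1 / 2 : ℝ) • (unitM₂ sf sm (M2Of d Lc tabs.mixFF j) κ u ρ w + sgnK (trK (unitM₂ sf sm (M2Of d Lc tabs.mixFF j) κ u ρ w)))) -
        W2SymOfK (unitK sf sm (GcombSh (d := d) Lc j)) Lc (unitS sf sm (SpureCombOf tabs cE cVH cΛ j)) (unitM sf sm (tabs.M j)) 0 0 := by
  have e : (fun μ y ν y' => ((1 : ℝ) / 2) • (WcombOf tabs cE cVH cΛ cE₂ cB T j μ y ν y'
        + sgnK (trK (WcombOf tabs cE cVH cΛ cE₂ cB T j μ y ν y')))) =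
      W2SymOfK (GcombSh (d := d) Lc j) Lc (SpureCombOf tabs cE cVH cΛ j) (tabs.M j)
          (fun κ u κ' u' => (1 / 2 : ℝ) • (T2RecOf d Lc (GcombSh Lc) (SpureCombOf tabs cE cVH cΛ) tabs.M cE₂ cB T tabs.vh₂S tabs.mixFF j κ u κ' u'
            + sgnK (trK (T2RecOf d Lc (GcombSh Lc) (SpureCombOf tabs cE cVH cΛ) tabs.M cE₂ cB T tabs.vh₂S tabs.mixFF j κ u κ' u'))))
          (fun κ u ρ w => (1 / 2 : ℝ) • (M2Of d Lc tabs.mixFF j κ u ρ w + sgnK (trK (M2Of d Lc tabs.mixFF j κ u ρ w)))) -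
        W2SymOfK (GcombSh (d := d) Lc j) Lc (SpureCombOf tabs cE cVH cΛ j) (tabs.M j) 0 0 := by
    funext μ y ν y'
    simp only [Pi.sub_apply]
    rw [W2SymOfK_zero_zero, evenHalf_WcombOf tabs cE cVH cΛ cE₂ cB T hVp hHp hMp j μ y ν y']
  rw [e, unitW_sub, unitW_W2SymOfK (N := Lc) hsf hsm, unitW_W2SymOfK (N := Lc) hsf hsm, unitS₂_zero, unitM₂_zero, unitS₂_evenHalf,
    unitM₂_evenHalf]

end Literal

/-- [folklore] **§1 AT an1's RECORD `symTablesAn1S2 d Lc cΛt`, PARITIES DISCHARGED** (an1's `trK_symVhSAt ∕ trK_symHessFFAt ∕ trK_M1Of_symHessFFAt`; NO hypothesis beyond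
`[NeZero Lc]` and the units being nonzero). -/
theorem unitW_evenHalf_WcombOf_an1 (cΛt cE cVH cΛ cE₂ cB : ℝ) (T : Fin 4 → Fin 4 → Fin 4 → Fin 4 → ℝ) {sf sm : ℝ} (hsf : sf ≠ 0) (hsm : sm ≠ 0) (j : ℕ) :
    unitW sf sm (fun μ y ν y' => ((1 : ℝ) / 2) • (WcombOf (symTablesAn1S2 d Lc cΛt) cE cVH cΛ cE₂ cB T j μ y ν y'
        + sgnK (trK (WcombOf (symTablesAn1S2 d Lc cΛt) cE cVH cΛ cE₂ cB T j μ y ν y')))) =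
      W2SymOfK (unitK sf sm (GcombSh (d := d) Lc j)) Lc (unitS sf sm (SpureCombOf (symTablesAn1S2 d Lc cΛt) cE cVH cΛ j))
          (unitM sf sm ((symTablesAn1S2 d Lc cΛt).M j))
          (((1 : ℝ) / 2) • (unitS₂ sf sm (T2RecOf d Lc (GcombSh Lc) (SpureCombOf (symTablesAn1S2 d Lc cΛt) cE cVH cΛ) (symTablesAn1S2 d Lc cΛt).M cE₂ cB T
              (symTablesAn1S2 d Lc cΛt).vh₂S (symTablesAn1S2 d Lc cΛt).mixFF j) + fun κ u κ' u' =>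
            sgnK (trK (unitS₂ sf sm (T2RecOf d Lc (GcombSh Lc) (SpureCombOf (symTablesAn1S2 d Lc cΛt) cE cVH cΛ) (symTablesAn1S2 d Lc cΛt).M cE₂ cB T
              (symTablesAn1S2 d Lc cΛt).vh₂S (symTablesAn1S2 d Lc cΛt).mixFF j) κ u κ' u'))))
          (fun κ u ρ w => (1 / 2 : ℝ) • (unitM₂ sf sm (M2Of d Lc (symTablesAn1S2 d Lc cΛt).mixFF j) κ u ρ w
            + sgnK (trK (unitM₂ sf sm (M2Of d Lc (symTablesAn1S2 d Lc cΛt).mixFF j) κ u ρ w)))) -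
        W2SymOfK (unitK sf sm (GcombSh (d := d) Lc j)) Lc (unitS sf sm (SpureCombOf (symTablesAn1S2 d Lc cΛt) cE cVH cΛ j))
          (unitM sf sm ((symTablesAn1S2 d Lc cΛt).M j)) 0 0 :=
  unitW_evenHalf_WcombOf (symTablesAn1S2 d Lc cΛt) cE cVH cΛ cE₂ cB T (fun κ u => trK_symVhSAt (ctr (d + 1) Lc) Lc κ u)
    (fun μ y => trK_symHessFFAt (ctr (d + 1) Lc) Lc μ y) (fun j ρ w => trK_M1Of_symHessFFAt (ctr (d + 1) Lc) cΛt j ρ w) hsf hsm j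

/-! ## §2 The symmetrised carrier over GENERIC slot families: uniform and geometric-Cauchy rows (road-P2's §2 with the three first-order slots as letters) -/

section Carrier

variable {Kf : ℕ → MKer (d + 1) (Fib d)} {Sf Mf : ℕ → Fin (d + 1) → (Fin (d + 1) → ℤ) → MKer (d + 1) (Fib d)}
  {U : ℕ → Fin (d + 1) → (Fin (d + 1) → ℤ) → Fin (d + 1) → (Fin (d + 1) → ℤ) → MKer (d + 1) (Fib d)}
  {N₂ : Fin (d + 1) → (Fin (d + 1) → ℤ) → Fin (d + 1) → (Fin (d + 1) → ℤ) → MKer (d + 1) (Fib d)}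
  {C δ cK θK Cs δs cS θS CM δM cM θM C₂ δ₂ c₂ θ₂ CM₂ δ₄ : ℝ}

/-- NOT IN PRINT; OUR BOOKKEEPING — A SOCKET ([folklore]; generic `d`, ANY slot families).  **THE SYMMETRISED CARRIER `W2SymOfK (Kf j) Lc (Sf j) (Mf j) (U j) N₂` IS
`j`-UNIFORMLY A VERTEX FAMILY** from `j`-uniform rows of the five slots (an1's `vertexFamily₂_W2SymOfK` at the common rate `m`, constant `CW2 d C Cs CM C₂ CM₂ m`, rate `m∕16`). -/
theorem vertexFamily₂_carrier_of_unitRows (hK : ∀ j, Decays (Kf j) C δ) (hδ : 0 < δ) (hS : ∀ j, LocStencil (Sf j) Cs δs) (hδs : 0 < δs)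
    (hM : ∀ j, VertexFamily (Mf j) Lc CM δM) (hδM : 0 < δM) (hU : ∀ j, LocStencil₂ (U j) C₂ δ₂) (hδ₂ : 0 < δ₂) (hN : LocStencilFM Lc N₂ CM₂ δ₄) (hδ₄ : 0 < δ₄) :
    ∃ Cw δW : ℝ, 0 < δW ∧ ∀ j, VertexFamily₂ (W2SymOfK (Kf j) Lc (Sf j) (Mf j) (U j) N₂) Lc Cw δW := by
  have hC : 0 ≤ C := (hK 0).nonneg (Sum.inl 0)
  have hCs : 0 ≤ Cs := ((hS 0) 0 0).nonneg (Sum.inl 0)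
  have hCM : 0 ≤ CM := ((hM 0) 0 0).nonneg (Sum.inl 0)
  set m : ℝ := min (min (min (min δ δs) δM) δ₂) δ₄ with hm_def
  have hm0 : 0 < m := lt_min (lt_min (lt_min (lt_min hδ hδs) hδM) hδ₂) hδ₄
  have hm4 : m ≤ δ₄ := min_le_right _ _
  have hm2 : m ≤ δ₂ := (min_le_left _ _).trans (min_le_right _ _)
  have hmM : m ≤ δM := (min_le_left _ _).trans ((min_le_left _ _).trans (min_le_right _ _))
  have hms : m ≤ δs := (min_le_left _ _).trans ((min_le_left _ _).trans ((min_le_left _ _).trans (min_le_right _ _)))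
  have hmK : m ≤ δ := (min_le_left _ _).trans ((min_le_left _ _).trans ((min_le_left _ _).trans (min_le_left _ _)))
  refine ⟨CW2 d C Cs CM C₂ CM₂ m, m / 16, by positivity, fun j => ?_⟩
  exact vertexFamily₂_W2SymOfK (decays_mono (hK j) hC le_rfl hmK) hC hm0 (locStencil_mono' (hS j) le_rfl hms)
    (fun μ w => biLoc_mono ((hM j) μ w) hCM hmM) ((hU j).mono hm2) (hN.mono hm4)

/-- NOT IN PRINT; OUR BOOKKEEPING — A SOCKET ([folklore]; generic `d`, ANY slot families).  **THE SAME CARRIER FAMILY IS CAUCHY AT A GEOMETRIC RATE** from the uniform AND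
drift rows of the K-, S-, M- and `S₂`-slots (ratios `θK θS θM θ₂`; the `j`-free `M₂`-slot does not move): `∀ k j, VertexFamily₂ (𝒲_{k+j} − 𝒲_k) Lc (cW·θW^k) δW`,
`θW = max (max θK θS) (max θM θ₂)` (leaf-07's `vertexFamily₂_W2SymOfK_sub`, `LW2_mul`). -/
theorem vertexFamily₂_carrier_cauchy_of_unitRows (hK : ∀ j, Decays (Kf j) C δ) (hKall : ∀ k j, Decays (Kf (k + j) - Kf k) (cK * θK ^ k) δ)
    (hδ : 0 < δ) (hθK0 : 0 ≤ θK) (hθK1 : θK < 1)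
    (hS : ∀ j, LocStencil (Sf j) Cs δs) (hSall : ∀ k j, LocStencil (Sf (k + j) - Sf k) (cS * θS ^ k) δs) (hδs : 0 < δs) (hθS0 : 0 ≤ θS) (hθS1 : θS < 1)
    (hM : ∀ j, VertexFamily (Mf j) Lc CM δM) (hMall : ∀ k j, VertexFamily (Mf (k + j) - Mf k) Lc (cM * θM ^ k) δM) (hδM : 0 < δM) (hθM0 : 0 ≤ θM)
    (hθM1 : θM < 1)
    (hU : ∀ j, LocStencil₂ (U j) C₂ δ₂) (hUd : ∀ k j, LocStencil₂ (U (k + j) - U k) (c₂ * θ₂ ^ k) δ₂) (hδ₂ : 0 < δ₂) (hθ₂0 : 0 ≤ θ₂) (hθ₂1 : θ₂ < 1)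
    (hN : LocStencilFM Lc N₂ CM₂ δ₄) (hδ₄ : 0 < δ₄) :
    ∃ cW θW δW : ℝ, 0 ≤ θW ∧ θW < 1 ∧ 0 < δW ∧ ∀ k j, VertexFamily₂
      (W2SymOfK (Kf (k + j)) Lc (Sf (k + j)) (Mf (k + j)) (U (k + j)) N₂ - W2SymOfK (Kf k) Lc (Sf k) (Mf k) (U k) N₂) Lc (cW * θW ^ k) δW := by
  have hC : 0 ≤ C := (hK 0).nonneg (Sum.inl 0)
  have hcK : 0 ≤ cK := by have h := (hKall 0 0).nonneg (Sum.inl 0); simpa using h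
  have hCs : 0 ≤ Cs := ((hS 0) 0 0).nonneg (Sum.inl 0)
  have hcS : 0 ≤ cS := by have h := ((hSall 0 0) 0 0).nonneg (Sum.inl 0); simpa using h
  have hCM : 0 ≤ CM := ((hM 0) 0 0).nonneg (Sum.inl 0)
  have hcM : 0 ≤ cM := by have h := ((hMall 0 0) 0 0).nonneg (Sum.inl 0); simpa using h
  have hc₂ : 0 ≤ c₂ := by have h := (hUd 0 0).nonneg; simpa using h
  set θW : ℝ := max (max θK θS) (max θM θ₂) with hθW_def
  have hθW0 : 0 ≤ θW := hθK0.trans ((le_max_left _ _).trans (le_max_left _ _))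
  have hθW1 : θW < 1 := max_lt (max_lt hθK1 hθS1) (max_lt hθM1 hθ₂1)
  have hKW : θK ≤ θW := (le_max_left _ _).trans (le_max_left _ _)
  have hSW : θS ≤ θW := (le_max_right _ _).trans (le_max_left _ _)
  have hMW : θM ≤ θW := (le_max_left _ _).trans (le_max_right _ _)
  have h2W : θ₂ ≤ θW := (le_max_right _ _).trans (le_max_right _ _)
  set m : ℝ := min δ (min δs (min δM (min δ₂ δ₄))) with hm_def
  have hm0 : 0 < m := lt_min hδ (lt_min hδs (lt_min hδM (lt_min hδ₂ hδ₄)))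
  have hmδ : m ≤ δ := min_le_left _ _
  have hms : m ≤ δs := (min_le_right _ _).trans (min_le_left _ _)
  have hmM : m ≤ δM := (min_le_right _ _).trans ((min_le_right _ _).trans (min_le_left _ _))
  have hm2 : m ≤ δ₂ := (min_le_right _ _).trans ((min_le_right _ _).trans ((min_le_right _ _).trans (min_le_left _ _)))
  have hm4 : m ≤ δ₄ := (min_le_right _ _).trans ((min_le_right _ _).trans ((min_le_right _ _).trans (min_le_right _ _)))
  have hNm : LocStencilFM Lc N₂ CM₂ m := hN.mono hm4
  refine ⟨LW2 d C Cs CM C₂ CM₂ cK cS cM c₂ 0 m, θW, m / 16, hθW0, hθW1, by positivity, fun k j => ?_⟩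
  have hK1 : Decays (Kf (k + j)) C m := decays_mono (hK (k + j)) hC le_rfl hmδ
  have hK0 : Decays (Kf k) C m := decays_mono (hK k) hC le_rfl hmδ
  have hKK : Decays (Kf (k + j) - Kf k) (cK * θW ^ k) m := decays_mono (hKall k j) (by positivity) (mul_pow_le_mul_pow hcK hθK0 hKW k) hmδ
  have hS1 : LocStencil (Sf (k + j)) Cs m := locStencil_mono' (hS (k + j)) le_rfl hms
  have hS0 : LocStencil (Sf k) Cs m := locStencil_mono' (hS k) le_rfl hms
  have hSS : LocStencil (Sf (k + j) - Sf k) (cS * θW ^ k) m := locStencil_mono' (hSall k j) (mul_pow_le_mul_pow hcS hθS0 hSW k) hms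
  have hM1 : VertexFamily (Mf (k + j)) Lc CM m := fun μ w => biLoc_mono ((hM (k + j)) μ w) hCM hmM
  have hM0 : VertexFamily (Mf k) Lc CM m := fun μ w => biLoc_mono ((hM k) μ w) hCM hmM
  have hMM : VertexFamily (Mf (k + j) - Mf k) Lc (cM * θW ^ k) m :=
    fun μ w => biLoc_le_mono ((hMall k j) μ w) (by positivity) (mul_pow_le_mul_pow hcM hθM0 hMW k) hmM
  have hT1 : LocStencil₂ (U (k + j)) C₂ m := locStencil₂_le_mono (hU (k + j)) le_rfl hm2
  have hT0 : LocStencil₂ (U k) C₂ m := locStencil₂_le_mono (hU k) le_rfl hm2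
  have hTT : LocStencil₂ (U (k + j) - U k) (c₂ * θW ^ k) m := locStencil₂_le_mono (hUd k j) (mul_pow_le_mul_pow hc₂ hθ₂0 h2W k) hm2
  have hθk : (0 : ℝ) ≤ 0 * θW ^ k := by positivity
  have hMM₂ : LocStencilFM Lc (N₂ - N₂) (0 * θW ^ k) m := by
    rw [sub_self]; exact locStencilFM_zero hθk
  have h := vertexFamily₂_W2SymOfK_sub (N := Lc) hK1 hK0 hKK hm0 hS1 hS0 hSS hM1 hM0 hMM hT1 hT0 hTT hNm hNm hMM₂
  rw [LW2_mul] at h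
  exact h

end Carrier

/-! ## §3 The W-slot rows (hW, hWall) of the EVEN HALF of `WcombOf` from the K-, S′-, M-slot rows and «T2Shape^{ev}» ∧ «T2Drift^{ev}» -/

section EvenHalf

variable (tabs : SymTables d Lc) (cE cVH cΛ cE₂ cB : ℝ) (T : Fin 4 → Fin 4 → Fin 4 → Fin 4 → ℝ)

/-- NOT IN PRINT; OUR BOOKKEEPING — A SOCKET ([folklore] assembly; generic `d`, ANY `tabs : SymTables d Lc`, all pins; R-gan24p1-g46-2 row L9 at (III′)).
**THE W-SLOT ROWS (hW, hWall) OF THE EVEN HALF `½ • (W′_j + P W′_j)` OF THE COMB-CHART W-TABLE `W′ = WcombOf tabs …` AS FUNCTIONS OF THE K-ROWS `(hK, hKall)` OF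
`unitK_j (GcombSh Lc j)`, «S′Shape» ∧ «S′Drift» `(hS, hSall)` ON `unitS_j (SpureCombOf tabs … j)`, THE MULTIPLIER-SLOT ROWS `(hM, hMall)` ON `unitM_j (tabs.M j)` AND THE TWO
ROWS «T2Shape^{ev}» `hT₂` ∧ «T2Drift^{ev}» `hT₂d` OF THE EVEN MEMBER `½ • (T̃′_j + P T̃′_j)`, `T̃′_j := unitS₂_j (T2RecOf d Lc (GcombSh Lc) (SpureCombOf tabs …) tabs.M … j)`**
(+ the table parities (V-p)(H-p)(M-p) and the mixed table's block letters `hfm hm`).  Route = road-P2's (E) §3 token for token (§1; §2 twice; `vertexFamily₂_sub'`;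
`sub_sub_sub_comm`).  ONE ratio `θW < 1`, ONE rate `δW > 0`.  The odd half of `W′` is never touched; NO displayed row is discharged here. -/
theorem hW_hWall_evenHalf_WcombOf_of_shapes {C δ cK θK : ℝ}
    (hK : ∀ j, Decays (unitK (sfStep Lc j) (smStep d Lc j) (GcombSh (d := d) Lc j)) C δ)
    (hKall : ∀ k j, Decays (unitK (sfStep Lc (k + j)) (smStep d Lc (k + j)) (GcombSh (d := d) Lc (k + j)) -
      unitK (sfStep Lc k) (smStep d Lc k) (GcombSh (d := d) Lc k)) (cK * θK ^ k) δ)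
    (hδ : 0 < δ) (hθK0 : 0 ≤ θK) (hθK1 : θK < 1)
    (hVp : ∀ (κ : Fin (d + 1)) (u : Fin (d + 1) → ℤ), trK (tabs.V κ u) = -sgnK (tabs.V κ u))
    (hHp : ∀ (μ : Fin (d + 1)) (y : Fin (d + 1) → ℤ), trK (tabs.H μ y) = -sgnK (tabs.H μ y))
    (hMp : ∀ (j : ℕ) (ρ : Fin (d + 1)) (w : Fin (d + 1) → ℤ), trK (tabs.M j ρ w) = -sgnK (tabs.M j ρ w))
    {Cs cS θS δs : ℝ} (hS : ∀ j, LocStencil (unitS (sfStep Lc j) (smStep d Lc j) (SpureCombOf tabs cE cVH cΛ j)) Cs δs)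
    (hSall : ∀ k j, LocStencil (unitS (sfStep Lc (k + j)) (smStep d Lc (k + j)) (SpureCombOf tabs cE cVH cΛ (k + j)) -
      unitS (sfStep Lc k) (smStep d Lc k) (SpureCombOf tabs cE cVH cΛ k)) (cS * θS ^ k) δs)
    (hδs : 0 < δs) (hθS0 : 0 ≤ θS) (hθS1 : θS < 1)
    {CM cM θM δM : ℝ} (hM : ∀ j, VertexFamily (unitM (sfStep Lc j) (smStep d Lc j) (tabs.M j)) Lc CM δM)
    (hMall : ∀ k j, VertexFamily (unitM (sfStep Lc (k + j)) (smStep d Lc (k + j)) (tabs.M (k + j)) - unitM (sfStep Lc k) (smStep d Lc k) (tabs.M k)) Lc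
      (cM * θM ^ k) δM)
    (hδM : 0 < δM) (hθM0 : 0 ≤ θM) (hθM1 : θM < 1)
    {C₂ c₂ θ₂ δ₂ : ℝ}
    (hT₂ : ∀ j, LocStencil₂ (((1 : ℝ) / 2) • (unitS₂ (sfStep Lc j) (smStep d Lc j)
        (T2RecOf d Lc (GcombSh Lc) (SpureCombOf tabs cE cVH cΛ) tabs.M cE₂ cB T tabs.vh₂S tabs.mixFF j) + fun κ u κ' u' =>
      sgnK (trK (unitS₂ (sfStep Lc j) (smStep d Lc j) (T2RecOf d Lc (GcombSh Lc) (SpureCombOf tabs cE cVH cΛ) tabs.M cE₂ cB T tabs.vh₂S tabs.mixFF j) κ u κ' u'))))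
      C₂ δ₂)
    (hT₂d : ∀ k j, LocStencil₂ (((1 : ℝ) / 2) • (unitS₂ (sfStep Lc (k + j)) (smStep d Lc (k + j))
          (T2RecOf d Lc (GcombSh Lc) (SpureCombOf tabs cE cVH cΛ) tabs.M cE₂ cB T tabs.vh₂S tabs.mixFF (k + j)) + fun κ u κ' u' =>
        sgnK (trK (unitS₂ (sfStep Lc (k + j)) (smStep d Lc (k + j))
          (T2RecOf d Lc (GcombSh Lc) (SpureCombOf tabs cE cVH cΛ) tabs.M cE₂ cB T tabs.vh₂S tabs.mixFF (k + j)) κ u κ' u'))) -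
      ((1 : ℝ) / 2) • (unitS₂ (sfStep Lc k) (smStep d Lc k) (T2RecOf d Lc (GcombSh Lc) (SpureCombOf tabs cE cVH cΛ) tabs.M cE₂ cB T tabs.vh₂S tabs.mixFF k) +
        fun κ u κ' u' => sgnK (trK (unitS₂ (sfStep Lc k) (smStep d Lc k)
          (T2RecOf d Lc (GcombSh Lc) (SpureCombOf tabs cE cVH cΛ) tabs.M cE₂ cB T tabs.vh₂S tabs.mixFF k) κ u κ' u')))) (c₂ * θ₂ ^ k) δ₂)
    (hδ₂ : 0 < δ₂) (hθ₂0 : 0 ≤ θ₂) (hθ₂1 : θ₂ < 1)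
    (hfm : ∀ κ u ρ w x z (α μ' : Fin (d + 1)), tabs.mixFF κ u ρ w x z (Sum.inl α) (Sum.inr μ') = 0)
    (hm : ∀ κ u ρ w x z (μ' : Fin (d + 1)) (b : Fib d), tabs.mixFF κ u ρ w x z (Sum.inr μ') b = 0) :
    ∃ Cw cW θW δW : ℝ, 0 ≤ θW ∧ θW < 1 ∧ 0 < δW ∧
      (∀ j, VertexFamily₂ (unitW (sfStep Lc j) (smStep d Lc j) (fun μ y ν y' => ((1 : ℝ) / 2) •
        (WcombOf tabs cE cVH cΛ cE₂ cB T j μ y ν y' + sgnK (trK (WcombOf tabs cE cVH cΛ cE₂ cB T j μ y ν y'))))) Lc Cw δW) ∧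
      (∀ k j, VertexFamily₂ (unitW (sfStep Lc (k + j)) (smStep d Lc (k + j)) (fun μ y ν y' => ((1 : ℝ) / 2) •
          (WcombOf tabs cE cVH cΛ cE₂ cB T (k + j) μ y ν y' + sgnK (trK (WcombOf tabs cE cVH cΛ cE₂ cB T (k + j) μ y ν y')))) -
        unitW (sfStep Lc k) (smStep d Lc k) (fun μ y ν y' => ((1 : ℝ) / 2) •
          (WcombOf tabs cE cVH cΛ cE₂ cB T k μ y ν y' + sgnK (trK (WcombOf tabs cE cVH cΛ cE₂ cB T k μ y ν y'))))) Lc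
        (cW * θW ^ k) δW) := by
  obtain ⟨CM₂, δ₄, hδ₄, hmix⟩ := tabs.hmix
  have hNev : LocStencilFM Lc (fun κ u ρ w => (1 / 2 : ℝ) • (tabs.mixFF κ u ρ w + sgnK (trK (tabs.mixFF κ u ρ w)))) CM₂ δ₄ :=
    locStencilFM_evenHalf hmix
  have hN0 : LocStencilFM Lc (0 : Fin (d + 1) → (Fin (d + 1) → ℤ) → Fin (d + 1) → (Fin (d + 1) → ℤ) → MKer (d + 1) (Fib d)) CM₂ δ₄ :=
    locStencilFM_zero hmix.nonneg
  have hU0 : ∀ j : ℕ, LocStencil₂ ((fun _ : ℕ => (0 : Fin (d + 1) → (Fin (d + 1) → ℤ) → Fin (d + 1) → (Fin (d + 1) → ℤ) → MKer (d + 1) (Fib d))) j) 0 δ₂ :=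
    fun _ => locStencil₂_zero_table
  have hU0d : ∀ k j : ℕ, LocStencil₂ ((fun _ : ℕ => (0 : Fin (d + 1) → (Fin (d + 1) → ℤ) → Fin (d + 1) → (Fin (d + 1) → ℤ) → MKer (d + 1) (Fib d))) (k + j) -
      (fun _ : ℕ => (0 : Fin (d + 1) → (Fin (d + 1) → ℤ) → Fin (d + 1) → (Fin (d + 1) → ℤ) → MKer (d + 1) (Fib d))) k) (0 * θ₂ ^ k) δ₂ := by
    intro k j
    rw [sub_self, zero_mul]
    exact locStencil₂_zero_table
  obtain ⟨CwA, δA, hδA, hA⟩ := vertexFamily₂_carrier_of_unitRows (Lc := Lc) hK hδ hS hδs hM hδM hT₂ hδ₂ hNev hδ₄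
  obtain ⟨CwB, δB, hδB, hB0⟩ := vertexFamily₂_carrier_of_unitRows (Lc := Lc) hK hδ hS hδs hM hδM hU0 hδ₂ hN0 hδ₄
  obtain ⟨cWA, θA, δA', hθA0, hθA1, hδA', hAd⟩ := vertexFamily₂_carrier_cauchy_of_unitRows (Lc := Lc) hK hKall hδ hθK0 hθK1 hS hSall hδs hθS0 hθS1 hM hMall
    hδM hθM0 hθM1 hT₂ hT₂d hδ₂ hθ₂0 hθ₂1 hNev hδ₄
  obtain ⟨cWB, θB, δB', hθB0, hθB1, hδB', hBd⟩ := vertexFamily₂_carrier_cauchy_of_unitRows (Lc := Lc) hK hKall hδ hθK0 hθK1 hS hSall hδs hθS0 hθS1 hM hMall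
    hδM hθM0 hθM1 hU0 hU0d hδ₂ hθ₂0 hθ₂1 hN0 hδ₄
  have hCwA : 0 ≤ CwA := ((hA 0) 0 0 0 0).nonneg (Sum.inl 0)
  have hCwB : 0 ≤ CwB := ((hB0 0) 0 0 0 0).nonneg (Sum.inl 0)
  have hcWA : 0 ≤ cWA := by have h := ((hAd 0 0) 0 0 0 0).nonneg (Sum.inl 0); simpa using h
  have hcWB : 0 ≤ cWB := by have h := ((hBd 0 0) 0 0 0 0).nonneg (Sum.inl 0); simpa using h
  set θW : ℝ := max θA θB with hθW_def
  have hθW0 : 0 ≤ θW := hθA0.trans (le_max_left _ _)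
  have hθW1 : θW < 1 := max_lt hθA1 hθB1
  set δW : ℝ := min (min δA δB) (min δA' δB') with hδW_def
  have hδW : 0 < δW := lt_min (lt_min hδA hδB) (lt_min hδA' hδB')
  refine ⟨CwA + CwB, cWA + cWB, θW, δW, hθW0, hθW1, hδW, fun j => ?_, fun k j => ?_⟩
  · rw [unitW_evenHalf_WcombOf tabs cE cVH cΛ cE₂ cB T hVp hHp hMp (sfStep_ne_zero j) (smStep_ne_zero j) j, unitM₂_M2Of_eq hfm hm]
    exact vertexFamily₂_sub' (vertexFamily₂_mono (hA j) hCwA ((min_le_left _ _).trans (min_le_left _ _)))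
      (vertexFamily₂_mono (hB0 j) hCwB ((min_le_left _ _).trans (min_le_right _ _)))
  · rw [unitW_evenHalf_WcombOf tabs cE cVH cΛ cE₂ cB T hVp hHp hMp (sfStep_ne_zero (k + j)) (smStep_ne_zero (k + j)) (k + j),
      unitW_evenHalf_WcombOf tabs cE cVH cΛ cE₂ cB T hVp hHp hMp (sfStep_ne_zero k) (smStep_ne_zero k) k, unitM₂_M2Of_eq hfm hm,
      unitM₂_M2Of_eq hfm hm, sub_sub_sub_comm, add_mul]
    exact vertexFamily₂_sub'
      (vertexFamily₂_mono' (hAd k j) (by positivity) (mul_pow_le_mul_pow hcWA hθA0 (le_max_left _ _) k) ((min_le_right _ _).trans (min_le_left _ _)))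
      (vertexFamily₂_mono' (hBd k j) (by positivity) (mul_pow_le_mul_pow hcWB hθB0 (le_max_right _ _) k) ((min_le_right _ _).trans (min_le_right _ _)))

end EvenHalf

/-! ## §4 `d = 3`, an1's record: the K-rows and the multiplier-slot rows DISCHARGED -/

/-- NOT IN PRINT; OUR BOOKKEEPING ([folklore] assembly).  **(hW, hWall) OF THE EVEN HALF OF `WcombOf (symTablesAn1S2 3 Lc cΛt) …` FROM «S′Shape» ∧ «S′Drift» ∧
«T2Shape^{ev}» ∧ «T2Drift^{ev}» ALONE** (`2 ≤ Lc`, every `cΛt` and all pins): §3 with the K-rows of `unitK_j (GcombSh Lc j)` DISCHARGED by MY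
`KSlotCombChart.kSlotCombSh_holds`, the multiplier-slot rows DISCHARGED by §0 (`unitM_j (M j) = cΛt • symHessFFAt ρ_c Lc`, `j`-free; an1's `symHessFFAt_hH_ctr`), the three
table parities by an1's `trK_symVhSAt ∕ trK_symHessFFAt ∕ trK_M1Of_symHessFFAt` and the mixed block letters by `symMixFFAt_inl_inr ∕ symMixFFAt_inr`.  The S′-rows and the
two T₂ rows stay DISPLAYED (their (III′) discharge is the S-campaign's ∕ the OWNER's T4 ∕ T5 under their own rows). -/
theorem hW_hWall_evenHalf_WcombOf_an1_three (hLc2 : 2 ≤ Lc) (cΛt cE cVH cΛ cE₂ cB : ℝ) (T : Fin 4 → Fin 4 → Fin 4 → Fin 4 → ℝ)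
    {Cs cS θS δs : ℝ} (hS : ∀ j, LocStencil (unitS (sfStep Lc j) (smStep 3 Lc j) (SpureCombOf (symTablesAn1S2 3 Lc cΛt) cE cVH cΛ j)) Cs δs)
    (hSall : ∀ k j, LocStencil (unitS (sfStep Lc (k + j)) (smStep 3 Lc (k + j)) (SpureCombOf (symTablesAn1S2 3 Lc cΛt) cE cVH cΛ (k + j)) -
      unitS (sfStep Lc k) (smStep 3 Lc k) (SpureCombOf (symTablesAn1S2 3 Lc cΛt) cE cVH cΛ k)) (cS * θS ^ k) δs)
    (hδs : 0 < δs) (hθS0 : 0 ≤ θS) (hθS1 : θS < 1)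
    {C₂ c₂ θ₂ δ₂ : ℝ}
    (hT₂ : ∀ j, LocStencil₂ (((1 : ℝ) / 2) • (unitS₂ (sfStep Lc j) (smStep 3 Lc j)
        (T2RecOf 3 Lc (GcombSh Lc) (SpureCombOf (symTablesAn1S2 3 Lc cΛt) cE cVH cΛ) (symTablesAn1S2 3 Lc cΛt).M cE₂ cB T (symTablesAn1S2 3 Lc cΛt).vh₂S
          (symTablesAn1S2 3 Lc cΛt).mixFF j) + fun κ u κ' u' =>
      sgnK (trK (unitS₂ (sfStep Lc j) (smStep 3 Lc j) (T2RecOf 3 Lc (GcombSh Lc) (SpureCombOf (symTablesAn1S2 3 Lc cΛt) cE cVH cΛ) (symTablesAn1S2 3 Lc cΛt).M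
        cE₂ cB T (symTablesAn1S2 3 Lc cΛt).vh₂S (symTablesAn1S2 3 Lc cΛt).mixFF j) κ u κ' u')))) C₂ δ₂)
    (hT₂d : ∀ k j, LocStencil₂ (((1 : ℝ) / 2) • (unitS₂ (sfStep Lc (k + j)) (smStep 3 Lc (k + j))
          (T2RecOf 3 Lc (GcombSh Lc) (SpureCombOf (symTablesAn1S2 3 Lc cΛt) cE cVH cΛ) (symTablesAn1S2 3 Lc cΛt).M cE₂ cB T (symTablesAn1S2 3 Lc cΛt).vh₂S
            (symTablesAn1S2 3 Lc cΛt).mixFF (k + j)) + fun κ u κ' u' =>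
        sgnK (trK (unitS₂ (sfStep Lc (k + j)) (smStep 3 Lc (k + j)) (T2RecOf 3 Lc (GcombSh Lc) (SpureCombOf (symTablesAn1S2 3 Lc cΛt) cE cVH cΛ)
          (symTablesAn1S2 3 Lc cΛt).M cE₂ cB T (symTablesAn1S2 3 Lc cΛt).vh₂S (symTablesAn1S2 3 Lc cΛt).mixFF (k + j)) κ u κ' u'))) -
      ((1 : ℝ) / 2) • (unitS₂ (sfStep Lc k) (smStep 3 Lc k) (T2RecOf 3 Lc (GcombSh Lc) (SpureCombOf (symTablesAn1S2 3 Lc cΛt) cE cVH cΛ) (symTablesAn1S2 3 Lc cΛt).M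
            cE₂ cB T (symTablesAn1S2 3 Lc cΛt).vh₂S (symTablesAn1S2 3 Lc cΛt).mixFF k) +
        fun κ u κ' u' => sgnK (trK (unitS₂ (sfStep Lc k) (smStep 3 Lc k) (T2RecOf 3 Lc (GcombSh Lc) (SpureCombOf (symTablesAn1S2 3 Lc cΛt) cE cVH cΛ)
          (symTablesAn1S2 3 Lc cΛt).M cE₂ cB T (symTablesAn1S2 3 Lc cΛt).vh₂S (symTablesAn1S2 3 Lc cΛt).mixFF k) κ u κ' u')))) (c₂ * θ₂ ^ k) δ₂)
    (hδ₂ : 0 < δ₂) (hθ₂0 : 0 ≤ θ₂) (hθ₂1 : θ₂ < 1) :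
    ∃ Cw cW θW δW : ℝ, 0 ≤ θW ∧ θW < 1 ∧ 0 < δW ∧
      (∀ j, VertexFamily₂ (unitW (sfStep Lc j) (smStep 3 Lc j) (fun μ y ν y' => ((1 : ℝ) / 2) •
        (WcombOf (symTablesAn1S2 3 Lc cΛt) cE cVH cΛ cE₂ cB T j μ y ν y' + sgnK (trK (WcombOf (symTablesAn1S2 3 Lc cΛt) cE cVH cΛ cE₂ cB T j μ y ν y'))))) Lc Cw δW) ∧
      (∀ k j, VertexFamily₂ (unitW (sfStep Lc (k + j)) (smStep 3 Lc (k + j)) (fun μ y ν y' => ((1 : ℝ) / 2) •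
          (WcombOf (symTablesAn1S2 3 Lc cΛt) cE cVH cΛ cE₂ cB T (k + j) μ y ν y'
            + sgnK (trK (WcombOf (symTablesAn1S2 3 Lc cΛt) cE cVH cΛ cE₂ cB T (k + j) μ y ν y')))) -
        unitW (sfStep Lc k) (smStep 3 Lc k) (fun μ y ν y' => ((1 : ℝ) / 2) •
          (WcombOf (symTablesAn1S2 3 Lc cΛt) cE cVH cΛ cE₂ cB T k μ y ν y'
            + sgnK (trK (WcombOf (symTablesAn1S2 3 Lc cΛt) cE cVH cΛ cE₂ cB T k μ y ν y'))))) Lc (cW * θW ^ k) δW) := by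
  have hLc1 : 1 ≤ Lc := le_trans (by norm_num) hLc2
  obtain ⟨C, δ, cK, θK, hδ, hθK0, hθK1, hK, hKall⟩ := kSlotCombSh_holds hLc2
  have hMu : ∀ j, unitM (sfStep Lc j) (smStep 3 Lc j) ((symTablesAn1S2 3 Lc cΛt).M j) = fun μ w => cΛt • symHessFFAt (ctr (3 + 1) Lc) Lc μ w :=
    unitM_symTablesAn1S2_M cΛt
  obtain ⟨CH, hH⟩ := symHessFFAt_hH_ctr (d := 3) hLc1 1 zero_le_one
  have hM : ∀ j, VertexFamily (unitM (sfStep Lc j) (smStep 3 Lc j) ((symTablesAn1S2 3 Lc cΛt).M j)) Lc (|cΛt| * CH) 1 := fun j => by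
    rw [hMu j]
    exact fun μ w => biLoc_smul cΛt (hH μ w)
  have hMall : ∀ k j, VertexFamily (unitM (sfStep Lc (k + j)) (smStep 3 Lc (k + j)) ((symTablesAn1S2 3 Lc cΛt).M (k + j))
      - unitM (sfStep Lc k) (smStep 3 Lc k) ((symTablesAn1S2 3 Lc cΛt).M k)) Lc (0 * (1 / 2 : ℝ) ^ k) 1 := fun k j => by
    rw [hMu, hMu, sub_self]
    exact vertexFamily_zero (by positivity)
  exact hW_hWall_evenHalf_WcombOf_of_shapes (symTablesAn1S2 3 Lc cΛt) cE cVH cΛ cE₂ cB T hK hKall hδ hθK0 hθK1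
    (fun κ u => trK_symVhSAt (ctr (3 + 1) Lc) Lc κ u) (fun μ y => trK_symHessFFAt (ctr (3 + 1) Lc) Lc μ y)
    (fun j ρ w => trK_M1Of_symHessFFAt (ctr (3 + 1) Lc) cΛt j ρ w) hS hSall hδs hθS0 hθS1 hM hMall one_pos (by norm_num) (by norm_num)
    hT₂ hT₂d hδ₂ hθ₂0 hθ₂1 (fun κ u ρ w x z α μ' => symMixFFAt_inl_inr (ctr (3 + 1) Lc) Lc κ u ρ w x z α μ')
    (fun κ u ρ w x z μ' b => symMixFFAt_inr (ctr (3 + 1) Lc) Lc κ u ρ w x z μ' b)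

end Summit.QuantumFields.BalabanUV.Beta.GAN24.CombWrecEvenHalfRows

end
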